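import Summits.Ventures.HSemireg.WeilFrameLeadingTermEulerPin
import Summits.Ventures.HSemireg.WeilFrameIdealShapePinZero

/-!
# Venture HSemireg — THE EULER-PIN VALUE OF TABLE R's «1 − ch(O_Z)» (I_Z-SHAPE) ROW AT THE EXTREME PIN `t = q_n²` of an EVEN `n`:
# `Σ_{k=0}^{2n} (−1)^k dim S_k(x) = (−1)ⁿ·(2C(2n−2,n−1) + 2n + 2 − δ)` with `δ = [det B_0 = 0] + dim ker(T_f + q_n)` (regular Hankel square)

HONEST FRAMING. Part of the Lean index of the computation cell `pub-hsemireg` (seat w3-mod4-1 gen 15, W3 SPECIAL FIBRES; MOD4-OFFSPLIT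
§13.29 ∕ §13.33–13.36). This file only combines FILE 46's row identity (whose side-degree inputs FILES 33 ∕ 36 already allow `q_0 ≠ 0`)
with FILE 58's `I_Z` middle entry at the extreme pin; the tree's real carriers and the Literature's Weil-type layer ONLY: no
semiregularity map, no Ext group, no `∫`, no HRR; nothing here says that HC / HC_CM / HC_AV holds, or that any object is or is not
semiregular; no Literature fact is declared; NO definition is introduced.

WHAT IS PROVED (hypotheses of `finrank_S_weilType_middle`, `n` even, `2 ≤ n`, `I_Z` shape: `q_0 ≠ 0`, `q_m = 0` for `1 ≤ m < n`,
`q_n ≠ 0`, any tail; pin `t = q_n²`; `Hsq = (q_{i+j})_{i,j≤n}` regular; `B_0` the pin block of `T_f(q⁰) − q_n`; `f := dim ker(T_f(q) + q_n) ≤ 1`):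
**`eulerSum_idealShape_pinZero_of_det_eq_zero`** (`det B_0 = 0` ⇒ `E(x) = (−1)ⁿ(2C(2n−2,n−1) + 2n + 2 − (1 + f))`) and
**`eulerSum_idealShape_pinZero_of_det_ne_zero`** (`det B_0 ≠ 0` ⇒ `E(x) = (−1)ⁿ(2C(2n−2,n−1) + 2n + 2 − f)`; `= e_n`, NO drop, when `f = 0`).
So at the extreme pin the `I_Z` row's Euler value is `e_n − (−1)ⁿ([det B_0 = 0] + f)` — one drop LESS than the `O_Z` row at the same
pin when `f = 0` (`n = 4`: `50 ∕ 49 ∕ 48` against `O_Z`'s `49 ∕ 48`). Everything PROVED, 0 sorry.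
References: [BuchweitzFlenner2008HH] Prop. 6.4.4; [vanGeemen1994HodgeAV] 4.9, Lemma 5.2; [BourbakiAlgebre1a3] Ch. III §8, §11 no. 9.
-/

noncomputable section

open CliffordAlgebra (contractLeft)
open ExteriorAlgebra (ι)
open Module CategoryTheory
open Literature.AlgebraicGeometry.Motives Literature.AlgebraicGeometry.HodgeTheory
open Literature.AlgebraicTopology.SingularHomology

namespace Summit.Ventures.HSemireg.WeilFrame

open Summit.Ventures.HSemireg.WedgeBridge Summit.Ventures.HSemireg.WeilCarrier Summit.Ventures.HSemireg.Mod4Carrier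
open Summit.Ventures.HSemireg.Wedge.Hankel

/-! ### 2. On the real carrier -/

section RealCarrier

variable {A : AbelianVariety ℂ}

/-- **`I_Z` row, Euler-pin value at the extreme pin `q_n²` (even `n ≥ 2`, regular Hankel square), DEGENERATE `O_Z` tail**
(`det B_0 = 0`): `Σ_{k ≤ 2n} (−1)^k dim S_k(x) = (−1)ⁿ (2C(2n−2,n−1) + 2n + 2 − (1 + dim ker(T_f + q_n)))`.
[cite: BuchweitzFlenner2008HH, Prop. 6.4.4] [cite: vanGeemen1994HodgeAV, 4.9 and Lemma 5.2] -/
theorem eulerSum_idealShape_pinZero_of_det_eq_zero (hA : IsSmoothProjective A.dim A.X) {n d : ℕ} (hdim : A.dim = n + n) (hd : 0 < d)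
    {φ : A ⟶ A} (hφ : φ ≫ φ = -(d • 𝟙 A)) {P Q : Submodule ℂ (complexBetti A.X 1)}
    (hP : P = Module.End.eigenspace (complexBetti.map φ.hom.hom.hom 1).hom (Complex.I * (Real.sqrt d : ℂ)))
    (hQ : Q = Module.End.eigenspace (complexBetti.map φ.hom.hom.hom 1).hom (-(Complex.I * (Real.sqrt d : ℂ))))
    (hp : finrank ℂ ↥(P ⊓ hodgeOneZero hA) = n) {h : complexBetti A.X 2}
    (hh : complexBetti.map φ.hom.hom.hom 2 h = (d : ℂ) • h) (h11 : IsOfHodgeType A.dim A.X 2 1 1 h)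
    (hvol : ((⋀[ℂ]^2 (complexBetti A.X 1)).subtype ((abelianVarietyCohomologyExteriorH1_holds.equiv A 2).symm h)) ^ (n + n) ≠ 0)
    {cP cQ : complexBetti A.X (2 * n)} (hcP : cP ∈ weilClassesPlus A φ n d) (hcP0 : cP ≠ 0)
    (hcQ : cQ ∈ weilClassesMinus A φ n d) (hcQ0 : cQ ≠ 0)
    {q : ℕ → ℂ} (hq : ∀ m, 1 ≤ m → m < n → q m = 0) (hq0 : q 0 ≠ 0) (hqn : q n ≠ 0) {t : ℂ}
    (ht : (((n + n).factorial : ℕ) : ℂ) •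
        ((⋀[ℂ]^(2 * n) (complexBetti A.X 1)).subtype ((abelianVarietyCohomologyExteriorH1_holds.equiv A (2 * n)).symm cP) *
          (⋀[ℂ]^(2 * n) (complexBetti A.X 1)).subtype ((abelianVarietyCohomologyExteriorH1_holds.equiv A (2 * n)).symm cQ)) =
      t • ((⋀[ℂ]^2 (complexBetti A.X 1)).subtype ((abelianVarietyCohomologyExteriorH1_holds.equiv A 2).symm h)) ^ (n + n))
    (hn2 : 2 ≤ n) (heven : Even n) (hpin : t = q n * q n) {B : Matrix (Fin n) (Fin n) ℂ}
    (hB : B = Matrix.of fun r s : Fin n =>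
      (Mod4.hankelT n (Function.update q 0 0) - q n • (1 : Matrix (Fin (n + 1)) (Fin (n + 1)) ℂ)) ⟨0 + r, by omega⟩
        ⟨0 + 1 + s, by omega⟩)
    {Hsq : Matrix (Fin (n + 1)) (Fin (n + 1)) ℂ} (hHsq : Hsq = Matrix.of fun i j : Fin (n + 1) => q ((i : ℕ) + (j : ℕ)))
    (hH : Hsq.det ≠ 0)
    (hdet : B.det = 0) :
    (∑ k ∈ Finset.range (n + n + 1), (-1 : ℤ) ^ k * (finrank ℂ ↥(S ℂ (hodgeZeroOne hA) k
        ((∑ m ∈ Finset.range (n + n + 1), (q m * ((m.factorial : ℕ) : ℂ)⁻¹) •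
            ((⋀[ℂ]^2 (complexBetti A.X 1)).subtype ((abelianVarietyCohomologyExteriorH1_holds.equiv A 2).symm h)) ^ m) +
          (⋀[ℂ]^(2 * n) (complexBetti A.X 1)).subtype ((abelianVarietyCohomologyExteriorH1_holds.equiv A (2 * n)).symm cP) +
          (⋀[ℂ]^(2 * n) (complexBetti A.X 1)).subtype ((abelianVarietyCohomologyExteriorH1_holds.equiv A (2 * n)).symm cQ))) : ℤ)) =
      (-1 : ℤ) ^ n * (2 * ((n + n - 2).choose (n - 1) : ℤ) + 2 * n + 2 - (1 + (finrank ℂ ↥(LinearMap.ker (Matrix.toLin' (Mod4.hankelT n q) + q n • LinearMap.id)) : ℤ))) := by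
  haveI : Module.Finite ℂ (complexBetti A.X 1) := abelianVarietyCohomologyExteriorH1_holds.finite_one A
  have hn : 2 ≤ n := hn2
  have hq0' : ∀ m, 1 ≤ m → m < n → q m = 0 := hq
  rw [show (2 * ((n + n - 2).choose (n - 1) : ℤ) + 2 * n + 2 - (1 + (finrank ℂ ↥(LinearMap.ker (Matrix.toLin' (Mod4.hankelT n q) + q n • LinearMap.id)) : ℤ))) =
      2 * ((n + n - 2).choose (n - 1) : ℤ) + 2 * n + 2 -
        ((1 + finrank ℂ ↥(LinearMap.ker (Matrix.toLin' (Mod4.hankelT n q) + q n • LinearMap.id)) : ℕ) : ℤ)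
    by push_cast; ring]
  have hn1 : 1 ≤ n := by omega
  have h0 := finrank_S_weilType_zero hA hdim hd hφ hP hQ hp hh h11 hvol hcP hcP0 hcQ hcQ0 hn1 q
  have htop := finrank_S_weilType_top hA hdim hd hφ hP hQ hp hh h11 hvol hcP hcP0 hcQ hcQ0 hn1 q
  refine alternating_sum_leading_row hn _ _ ?_ ?_ ?_
  · intro k hk
    rcases Nat.eq_zero_or_pos k with rfl | hk1
    · rw [h0, Nat.choose_zero_right, Nat.choose_zero_right]
    · exact finrank_S_leading_deg hA hdim hd hφ hP hQ hp hh h11 hvol hcP hcP0 hcQ hcQ0 hq0' hqn hk1 hk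
  · intro k hk
    rcases Nat.eq_zero_or_pos k with rfl | hk1
    · rw [Nat.sub_zero, htop, Nat.choose_zero_right, Nat.choose_zero_right]
    · exact finrank_S_leading_deg_dual hA hdim hd hφ hP hQ hp hh h11 hvol hcP hcP0 hcQ hcQ0 hq0' hqn (k := n + n - k)
        (k' := k) hk1 hk (by omega)
  · have h := finrank_S_idealShape_middle_pinZero_of_det_eq_zero hA (by omega) heven hdim hd hφ hP hQ hp hh h11 hvol hcP hcP0 hcQ
      hcQ0 hq hq0 hqn ht hpin hB hHsq hH hdet
    omega

/-- **`I_Z` row, Euler-pin value at the extreme pin `q_n²` (even `n ≥ 2`, regular Hankel square), GENERIC `O_Z` tail**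
(`det B_0 ≠ 0`): `Σ_{k ≤ 2n} (−1)^k dim S_k(x) = (−1)ⁿ (2C(2n−2,n−1) + 2n + 2 − dim ker(T_f + q_n))` (`= e_n`, no drop, when that kernel is `⊥`).
[cite: BuchweitzFlenner2008HH, Prop. 6.4.4] [cite: vanGeemen1994HodgeAV, 4.9 and Lemma 5.2] -/
theorem eulerSum_idealShape_pinZero_of_det_ne_zero (hA : IsSmoothProjective A.dim A.X) {n d : ℕ} (hdim : A.dim = n + n) (hd : 0 < d)
    {φ : A ⟶ A} (hφ : φ ≫ φ = -(d • 𝟙 A)) {P Q : Submodule ℂ (complexBetti A.X 1)}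
    (hP : P = Module.End.eigenspace (complexBetti.map φ.hom.hom.hom 1).hom (Complex.I * (Real.sqrt d : ℂ)))
    (hQ : Q = Module.End.eigenspace (complexBetti.map φ.hom.hom.hom 1).hom (-(Complex.I * (Real.sqrt d : ℂ))))
    (hp : finrank ℂ ↥(P ⊓ hodgeOneZero hA) = n) {h : complexBetti A.X 2}
    (hh : complexBetti.map φ.hom.hom.hom 2 h = (d : ℂ) • h) (h11 : IsOfHodgeType A.dim A.X 2 1 1 h)
    (hvol : ((⋀[ℂ]^2 (complexBetti A.X 1)).subtype ((abelianVarietyCohomologyExteriorH1_holds.equiv A 2).symm h)) ^ (n + n) ≠ 0)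
    {cP cQ : complexBetti A.X (2 * n)} (hcP : cP ∈ weilClassesPlus A φ n d) (hcP0 : cP ≠ 0)
    (hcQ : cQ ∈ weilClassesMinus A φ n d) (hcQ0 : cQ ≠ 0)
    {q : ℕ → ℂ} (hq : ∀ m, 1 ≤ m → m < n → q m = 0) (hq0 : q 0 ≠ 0) (hqn : q n ≠ 0) {t : ℂ}
    (ht : (((n + n).factorial : ℕ) : ℂ) •
        ((⋀[ℂ]^(2 * n) (complexBetti A.X 1)).subtype ((abelianVarietyCohomologyExteriorH1_holds.equiv A (2 * n)).symm cP) *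
          (⋀[ℂ]^(2 * n) (complexBetti A.X 1)).subtype ((abelianVarietyCohomologyExteriorH1_holds.equiv A (2 * n)).symm cQ)) =
      t • ((⋀[ℂ]^2 (complexBetti A.X 1)).subtype ((abelianVarietyCohomologyExteriorH1_holds.equiv A 2).symm h)) ^ (n + n))
    (hn2 : 2 ≤ n) (heven : Even n) (hpin : t = q n * q n) {B : Matrix (Fin n) (Fin n) ℂ}
    (hB : B = Matrix.of fun r s : Fin n =>
      (Mod4.hankelT n (Function.update q 0 0) - q n • (1 : Matrix (Fin (n + 1)) (Fin (n + 1)) ℂ)) ⟨0 + r, by omega⟩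
        ⟨0 + 1 + s, by omega⟩)
    {Hsq : Matrix (Fin (n + 1)) (Fin (n + 1)) ℂ} (hHsq : Hsq = Matrix.of fun i j : Fin (n + 1) => q ((i : ℕ) + (j : ℕ)))
    (hH : Hsq.det ≠ 0)
    (hdet : B.det ≠ 0) :
    (∑ k ∈ Finset.range (n + n + 1), (-1 : ℤ) ^ k * (finrank ℂ ↥(S ℂ (hodgeZeroOne hA) k
        ((∑ m ∈ Finset.range (n + n + 1), (q m * ((m.factorial : ℕ) : ℂ)⁻¹) •
            ((⋀[ℂ]^2 (complexBetti A.X 1)).subtype ((abelianVarietyCohomologyExteriorH1_holds.equiv A 2).symm h)) ^ m) +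
          (⋀[ℂ]^(2 * n) (complexBetti A.X 1)).subtype ((abelianVarietyCohomologyExteriorH1_holds.equiv A (2 * n)).symm cP) +
          (⋀[ℂ]^(2 * n) (complexBetti A.X 1)).subtype ((abelianVarietyCohomologyExteriorH1_holds.equiv A (2 * n)).symm cQ))) : ℤ)) =
      (-1 : ℤ) ^ n * (2 * ((n + n - 2).choose (n - 1) : ℤ) + 2 * n + 2 - (finrank ℂ ↥(LinearMap.ker (Matrix.toLin' (Mod4.hankelT n q) + q n • LinearMap.id)) : ℤ)) := by
  haveI : Module.Finite ℂ (complexBetti A.X 1) := abelianVarietyCohomologyExteriorH1_holds.finite_one A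
  have hn : 2 ≤ n := hn2
  have hq0' : ∀ m, 1 ≤ m → m < n → q m = 0 := hq

  have hn1 : 1 ≤ n := by omega
  have h0 := finrank_S_weilType_zero hA hdim hd hφ hP hQ hp hh h11 hvol hcP hcP0 hcQ hcQ0 hn1 q
  have htop := finrank_S_weilType_top hA hdim hd hφ hP hQ hp hh h11 hvol hcP hcP0 hcQ hcQ0 hn1 q
  refine alternating_sum_leading_row hn _ _ ?_ ?_ ?_
  · intro k hk
    rcases Nat.eq_zero_or_pos k with rfl | hk1
    · rw [h0, Nat.choose_zero_right, Nat.choose_zero_right]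
    · exact finrank_S_leading_deg hA hdim hd hφ hP hQ hp hh h11 hvol hcP hcP0 hcQ hcQ0 hq0' hqn hk1 hk
  · intro k hk
    rcases Nat.eq_zero_or_pos k with rfl | hk1
    · rw [Nat.sub_zero, htop, Nat.choose_zero_right, Nat.choose_zero_right]
    · exact finrank_S_leading_deg_dual hA hdim hd hφ hP hQ hp hh h11 hvol hcP hcP0 hcQ hcQ0 hq0' hqn (k := n + n - k)
        (k' := k) hk1 hk (by omega)
  · exact finrank_S_idealShape_middle_pinZero_of_det_ne_zero hA (by omega) heven hdim hd hφ hP hQ hp hh h11 hvol hcP hcP0 hcQ hcQ0 hq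
      hq0 hqn ht hpin hB hHsq hH hdet

end RealCarrier

end Summit.Ventures.HSemireg.WeilFrame

end
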